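import Literature.AlgebraicGeometry.HodgeTheory.SignSymmetricOrbitDataAssembly
import HarnessLib

/-!
# The link `⟨r, Γδ⟩ ≠ 0` from a confluence whose two local monodromies merely do NOT COMMUTE

Family `hodge`, layer `Literature/AlgebraicGeometry/HodgeTheory`; sequel of `SignSymmetricOrbitDataAssembly` §4 (theorems only).
Written by the prover seat `hodge-nonav-19716-p2` (g9, cell `hodge-nonav`), phase «N-ONLY» for crux K1-B
`VeryGeneralSignCommutatorsInHg` (`Summits/HodgeConjecture/HodgeConjecture/Theses/SignSymmetricPowers.lean`, stmt-HodgeConjecture-19716).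

`exists_link_of_conjugate_confluence` assumes the `A₃` chain `(c₀⟨e₁,e₂⟩)² = (c₀⟨e₂,e₃⟩)² = 1` at the confluence point and uses it only
through `c₀ ≠ 0`, `e₂ ≠ 0` and `c₀⟨e₂, w⟩ = 2 ≠ 0`, `w := (U_{e₁}(c₀)U_{e₃}(c₀) − 1)e₂ = c₀⟨e₂,e₃⟩e₃ + c₀⟨e₂,e₁⟩e₁` (the seat's memo
PROGRAMME-B2PLSPLIT §3).  Here the hypothesis is weakened to exactly that: `c₀⟨e₂, w⟩ ≠ 0` — over an ordered field this is the
gauge-invariant form of «the two local monodromies `U_{e₂}(c₀)` and `U_{e₁}(c₀)U_{e₃}(c₀)` do not commute» (`c₀⟨e₂,w⟩ =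
(c₀⟨e₂,e₁⟩)² + (c₀⟨e₂,e₃⟩)²`), which is what the registry binder hN (`SymmetricA3NonCommutation`) supplies.

* `exists_link_of_conjugate_confluence_of_ne` — the link from `⟨e₁,e₃⟩ = 0` and `c₀⟨e₂,w⟩ ≠ 0` alone.
* `mul_apply_w_eq_sum_sq` — `c₀⟨e₂, w⟩ = (c₀⟨e₂,e₁⟩)² + (c₀⟨e₂,e₃⟩)²` (so over `ℚ` it is `≠ 0` iff `(⟨e₂,e₁⟩, ⟨e₂,e₃⟩) ≠ 0`).

References: [Deligne1980] P. Deligne, *La conjecture de Weil : II*, §4.4 (4.4.2^α)–(4.4.4^α), pp. 227–228.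
-/

noncomputable section

namespace Literature.AlgebraicGeometry.HodgeTheory

open Literature.AlgebraicGeometry.Motives Literature.LinearAlgebra.Alternating

universe u v

variable {K : Type u} [Field K] {V : Type v} [AddCommGroup V] [Module K V] {B : LinearMap.BilinForm K V}

/-- `c₀⟨e₂, w⟩ = (c₀⟨e₂,e₁⟩)² + (c₀⟨e₂,e₃⟩)²` for `w = c₀⟨e₂,e₃⟩e₃ + c₀⟨e₂,e₁⟩e₁`. [cite: Deligne1980, §4.4 (4.4.3^α) p. 227] -/
theorem mul_apply_w_eq_sum_sq (e₁ e₂ e₃ : V) (c₀ : K) :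
    c₀ * B e₂ ((c₀ * B e₂ e₃) • e₃ + (c₀ * B e₂ e₁) • e₁) = (c₀ * B e₂ e₁) ^ 2 + (c₀ * B e₂ e₃) ^ 2 := by
  rw [map_add, map_smul, map_smul, smul_eq_mul, smul_eq_mul]
  ring

/-- **The link from a non-commuting confluence.**  Setting of `exists_link_of_conjugate_confluence`, with the `A₃`-chain
hypotheses replaced by `c₀⟨e₂, w⟩ ≠ 0` (`w = c₀⟨e₂,e₃⟩e₃ + c₀⟨e₂,e₁⟩e₁`): if the transvection `U_r(c)` (`τ r = ±r`) and the pair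
`U_δ(c')U_{τδ}(c')` are `Γ`-conjugate to `U_{e₂}(c₀)` and `U_{e₁}(c₀)U_{e₃}(c₀)` (`⟨e₁, e₃⟩ = 0`), then `⟨r, hδ⟩ ≠ 0` for some `h ∈ Γ`.
Proof verbatim as there: `c⟨x,r⟩r = c₀⟨x,ge₂⟩ge₂`, `g'w ∈ span{δ, τδ}`, and if all links vanished then `⟨x, ge₂⟩·c₀⟨e₂,w⟩ = 0` for
all `x`, so `e₂ = 0`, contradicting `c₀⟨e₂,w⟩ ≠ 0`. [cite: Deligne1980, §4.4 (4.4.2^α)–(4.4.4^α) pp. 227–228] -/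
theorem exists_link_of_conjugate_confluence_of_ne (hB : B.IsAlt) (hBn : B.Nondegenerate)
    {τ : V →ₗ[K] V} (hτ : τ ^ 2 = 1) (hτB : ∀ x y, B (τ x) (τ y) = B x y)
    {Γ : Subgroup (V ≃ₗ[K] V)} (hΓτ : ∀ g ∈ Γ, ∀ x, g (τ x) = τ (g x))
    (hΓB : ∀ g ∈ Γ, ∀ x y, B (g x) (g y) = B x y)
    {e₁ e₂ e₃ : V} {c₀ : K} (h13 : B e₁ e₃ = 0)
    (hBw : c₀ * B e₂ ((c₀ * B e₂ e₃) • e₃ + (c₀ * B e₂ e₁) • e₁) ≠ 0)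
    {r δ : V} {c c' : K} (hr : τ r = r ∨ τ r = -r) {g g' : V ≃ₗ[K] V} (hg : g ∈ Γ) (hg' : g' ∈ Γ)
    (hT : oneParamTransvectionEquiv B (hB r) c = g * oneParamTransvectionEquiv B (hB e₂) c₀ * g⁻¹)
    (hT' : oneParamTransvectionEquiv B (hB δ) c' * oneParamTransvectionEquiv B (hB (τ δ)) c' =
      g' * (oneParamTransvectionEquiv B (hB e₁) c₀ * oneParamTransvectionEquiv B (hB e₃) c₀) * g'⁻¹) :
    ∃ h ∈ Γ, B r (h δ) ≠ 0 := by
  have hττ : ∀ x, τ (τ x) = x := fun x => by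
    rw [← Module.End.mul_apply, ← pow_two, hτ, Module.End.one_apply]
  have hc₀ : c₀ ≠ 0 := by rintro rfl; rw [zero_mul] at hBw; exact hBw rfl
  -- (a) `U_r(c) = U_{g e₂}(c₀)` pointwise
  have ha : ∀ x, (c * B x r) • r = (c₀ * B x (g e₂)) • g e₂ := by
    intro x
    have h := LinearEquiv.congr_fun (hT.trans (conj_oneParamTransvectionEquiv hB (hΓB g hg) e₂ c₀)) x
    rw [oneParamTransvectionEquiv_apply, oneParamTransvectionEquiv_apply] at h
    exact add_left_cancel h
  -- (b) the vector `w`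
  set w : V := (c₀ * B e₂ e₃) • e₃ + (c₀ * B e₂ e₁) • e₁ with hw
  have hTw : (oneParamTransvectionEquiv B (hB e₁) c₀ * oneParamTransvectionEquiv B (hB e₃) c₀) e₂ = e₂ + w := by
    have h31 : B e₃ e₁ = 0 := by rw [← hB.neg_eq, h13, neg_zero]
    rw [LinearEquiv.mul_apply, oneParamTransvectionEquiv_apply, oneParamTransvectionEquiv_apply, map_add,
      LinearMap.add_apply, map_smul, LinearMap.smul_apply, h31, smul_eq_mul, mul_zero, add_zero, hw, add_assoc]
  -- (c) `g' w ∈ span{δ, τδ}`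
  obtain ⟨α, β, hαβ⟩ : ∃ α β : K, g' w = α • δ + β • τ δ := by
    have h := LinearEquiv.congr_fun hT' (g' e₂)
    rw [LinearEquiv.mul_apply, LinearEquiv.mul_apply, LinearEquiv.mul_apply,
      show g'⁻¹ (g' e₂) = e₂ by rw [← LinearEquiv.mul_apply, inv_mul_cancel, LinearEquiv.coe_one, id_eq], hTw, map_add,
      oneParamTransvectionEquiv_apply, oneParamTransvectionEquiv_apply, map_add, LinearMap.add_apply, map_smul,
      LinearMap.smul_apply] at h
    refine ⟨c' * (B (g' e₂) δ + (c' * B (g' e₂) (τ δ)) • B (τ δ) δ), c' * B (g' e₂) (τ δ), ?_⟩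
    have h2 : g' w = (g' e₂ + g' w) - g' e₂ := by abel
    rw [h2, ← h]
    module
  -- (d) suppose all links vanish
  by_contra hcon
  push Not at hcon
  have hconτ : ∀ h ∈ Γ, B r (h (τ δ)) = 0 := by
    intro h hh
    rw [hΓτ h hh]
    have e : B r (τ (h δ)) = B (τ r) (h δ) := by
      conv_lhs => rw [← hττ r]
      rw [hτB]
    rw [e]
    rcases hr with hr | hr
    · rw [hr, hcon h hh]
    · rw [hr, map_neg, LinearMap.neg_apply, hcon h hh, neg_zero]
  have hgw : B r (g w) = 0 := by
    have hmem : g * g'⁻¹ ∈ Γ := Γ.mul_mem hg (Γ.inv_mem hg')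
    have e : g w = (g * g'⁻¹) (g' w) := by
      rw [LinearEquiv.mul_apply, ← LinearEquiv.mul_apply g'⁻¹, inv_mul_cancel, LinearEquiv.coe_one, id_eq]
    rw [e, hαβ, map_add, map_smul, map_smul, map_add, map_smul, map_smul, smul_eq_mul, smul_eq_mul, hcon _ hmem,
      hconτ _ hmem, mul_zero, mul_zero, add_zero]
  -- pairing (a) with `g w`: `⟨x, g e₂⟩ · c₀⟨e₂, w⟩ = 0` for all `x`, hence `e₂ = 0`
  have hzero : ∀ x, B x (g e₂) = 0 := by
    intro x
    have h := congrArg (fun v => c₀ * B v (g w)) (ha x)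
    simp only [map_smul, LinearMap.smul_apply, smul_eq_mul, hgw, mul_zero, hΓB g hg] at h
    -- h : 0 = c₀ * (c₀ * B x (g e₂) * B e₂ w)
    have h' : B x (g e₂) * (c₀ * B e₂ w) = 0 := by
      have := h.symm
      rcases mul_eq_zero.1 this with h0 | h0
      · exact absurd h0 hc₀
      · linear_combination h0
    exact (mul_eq_zero.1 h').resolve_right hBw
  have he₂ : g e₂ = 0 := by
    refine hBn.2 (g e₂) fun x => ?_
    exact hzero x
  have he₂' : e₂ = 0 := (LinearEquiv.map_eq_zero_iff g).1 he₂
  apply hBw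
  rw [he₂', map_zero, LinearMap.zero_apply, mul_zero]

end Literature.AlgebraicGeometry.HodgeTheory

end
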